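/-
Copyright (c) 2026 the pub-hodgecm-mathlib formalisation cell (harness21).  Prover seat hodgecm-mathlib-K2E1-p11 (g4), Track B ∕ K2-LIT, h413 = `stmt-HodgeConjecture-24833`,
R90-TF section S8 «ContSpec-n½», #2 road (G side), S8 dealer R90-CS-plan (g2) S8-R120 ∕ (g3) S8-R129 «H-a HEADS =» (census `R90/S8/CENSUS-HEAD3.K2E1-p11-g4.md` a14494c7b38dc692):
the cut H-a of the LEVEL exhaustion letter (HEAD₃) — THE N = 3 WORLD BRIDGE: ★ f1's unconditional cuspidal density `(L²_cusp(U(Φ₃)))ᗮ = closure span {[θ_Φ] : Φ ∈ 𝒯}` (★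
`cmCuspidalSubspaceR_orthogonal_eq_topologicalClosure_span_three`, literal form `Φ₃`, `cmParabolicDataR L 3`) transported to Mok's `quasiSplit L⁺ L c 3` (form `(antidiagonal 3).over L`,
Heisenberg radical `adelicUnipotent L⁺ L c 3`) — the world of `eisensteinSeriesU` ∕ `resGBlock` ∕ the `𝔓` of `hHead_level`; twin of ★ `K2E1CuspidalDensityQuasiSplitBridgeCMTwo`.
-/
import Summits.HodgeConjecture.HodgeConjecture.Theorems.K2E1PseudoEisensteinDensityU                 -- ★ f1-CM (K2E1-p09): `cmCuspidalSubspaceR_orthogonal_eq_topologicalClosure_span_three`; brings ★ `cmParabolicDataR`, ★ p855771 `upperUnitriangular_eq_flagUnipotentRadical_three`, ★ `antidiagOne_eq_over`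
import Summits.HodgeConjecture.HodgeConjecture.Theorems.K2E1CuspidalDensityQuasiSplitBridgeCMTwo      -- ★ (K2E1-p10) §3 GENERIC radical-only lemmas `toSubmodule_cuspidalSubspace_eq_of_forall_radical_eq`, `setOf_pseudoEisenstein_eq_of_forall_radical_eq`
import Literature.NumberTheory.Automorphic.UnitaryGroupGenericity                                     -- ★ `adelicUnipotent`, `mem_adelicUnipotent_iff`
import HarnessLib

/-!
# S8 #2 road (G side) — `R90S8CuspOrthogonalLePseudoEisensteinClosureU3`: in the `quasiSplit L⁺ L c 3` world the orthogonal complement of the cuspidal subspace is the CLOSED SPAN of the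
# square-integrable pseudo-Eisenstein series along the Heisenberg radical — `(L²_cusp)ᗮ = closure span Θ`, for EVERY Borel parabolic datum `𝔓` with radicals `= adelicUnipotent L⁺ L c 3`

Track B ∕ K2-LIT, crux h413 = `stmt-HodgeConjecture-24833`, route of record `HCCMUnconditional`; cell `hodgecm-mathlib`, R90-TF programme, section S8 «ContSpec-n½», socket #2's ED. 5
sub-socket (E) (`Lines/R90_S8_ResidualSpectrumU3B.lean` :231).  THEOREMS ONLY (no `def`, no `instance`, no `notation`, no named-fact hypothesis, no `sorry`; default heartbeats); lane
`--supports stmt-HodgeConjecture-24833 --as helper` (count-neutral).  CLOSES NO SOCKET.  WHY: the LEVEL exhaustion letter (HEAD₃) = `hHead_level` of ★ p862893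
`R90S8KTypeProjectionGlueU3.hHead_kType_of_level_three` — «`(cuspidalSubspace μ 𝔓)ᗮ ⊓ Fix(ι_f Kf) ≤ cl ⨆_b resGBlock L μ (Kf.map ι_f) 1 (χ₁ b) (χ₂ b)`» [MW II.2.4] — starts from the density
`(cuspidalSubspace μ 𝔓)ᗮ = closure span Θ` for the Borel datum `𝔓` OF `quasiSplit L⁺ L c 3`; the tree proves that density (★ f1, unconditional) only in the literal `cmDatum L 3 Φ₃` world.  This file is
the bridge (H-a of the census); the generic level cut ★ `K2E1PseudoEisensteinNiceGenerators(KType)U` consumes its conclusion as the hypothesis «`Wᗮ = closure span Θ`», and the remaining road to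
`hHead_level` is the N = 3 twin of the E1 C7 HEAD″ ★ p861008 (Borel periodization, two-character torus Fourier decomposition, open `(B(𝔸), K′)` double cosets, nice-class `memLp`,
generator core — census items (m1)–(m5), NOT claimed here).

THE TWO WORLDS (verbatim the device of ★ `K2E1CuspidalDensityQuasiSplitBridgeCMTwo`).  ★ f1 speaks of `cmDatum L 3 Φ₃` with the literal antidiagonal-one matrix `Φ₃ = Matrix.of …` and the
parabolic datum ★ `cmParabolicDataR L 3` (ONE radical, index `{k // 1 ≤ k ∧ 2k ≤ 3} = {1}`: the Heisenberg radical `val⁻¹(R_u(P_{(1,1,1)})) = val⁻¹(flagUnipotentRadical 3 1)`); the S8 G-side files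
speak of Mok's `quasiSplit L⁺ L c 3 = adelicGroupData L⁺ L c 3 ((StdForm.antidiagonal 3).over L)` (`rfl`).  The two matrices are EQUAL (★ `antidiagOne_eq_over`) but not definitionally, so: state the
density for `adelicGroupData L⁺ L c 3 J` with `J` ANY matrix equal to `Φ₃` and an EXISTENTIAL parabolic datum whose radicals are the inline comap `val_J⁻¹(flagUnipotentRadical 3 1)`, prove it at
`J = Φ₃` by `subst` from ★ f1 with the witness `cmParabolicDataR L 3` (§1); read it at `J = (StdForm.antidiagonal 3).over L`, where `val⁻¹(flagUnipotentRadical 3 1) = val⁻¹(upper unitriangular)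
= adelicUnipotent` (★ p855771 `upperUnitriangular_eq_flagUnipotentRadical_three`, ★ `mem_adelicUnipotent_iff`) (§2); and pass to EVERY Borel datum with the same radicals by ★ CMTwo §3's GENERIC
lemmas «the cuspidal subspace and the generating set `Θ(𝔓)` depend only on the SET of radicals» (§3).
* §1 `exists_parabolicData_orthogonal_eq_of_eq_three` (`J`-generic by `subst`, non-emptiness of the index exported).
* §2 **`exists_parabolicData_orthogonal_eq_quasiSplit_three`**: `∃ 𝔓 : (quasiSplit L⁺ L c 3).ParabolicUnipotentData, Nonempty 𝔓.ι ∧ (∀ i, 𝔓.radical i = adelicUnipotent L⁺ L c 3) ∧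
  ∀ μ automorphic, ((quasiSplit …).cuspidalSubspace μ 𝔓).toSubmoduleᗮ = (span ℂ Θ(𝔓, μ)).topologicalClosure` (Θ in ★ f1's `hθ`-witness shape).
* §3 **`orthogonal_eq_topologicalClosure_span_of_borel_three`** (∀-GUARDED: every `𝔓` with non-empty index and radicals `= adelicUnipotent` — the `𝔓` of `hHead_level`; NOT the junk datum
  `⟨PEmpty, nofun⟩`) and the named half **`cuspidalSubspace_orthogonal_le_topologicalClosure_span_of_borel_three`** (the `≤` that (HEAD₃) and the generic level cut consume).
HONEST LABEL: HC_CM is proved only modulo the 7 printed citations (2 remaining named inputs: hLiu418 = `stmt-HodgeConjecture-24832`, h413 = `stmt-HodgeConjecture-24833`) until rung 0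
closes; REL ≠ ★ ≠ BUILT; this file asserts no named fact and closes no socket — it is one honest slice (H-a) of (HEAD₃), not the letter; count-neutral.

## References
* [MoeglinWaldspurger1995] C. Mœglin, J.-L. Waldspurger, *Spectral Decomposition and Eisenstein Series* (1995), II.1.2–II.1.4, II.2.4.
* [BorelJacquet1979] A. Borel, H. Jacquet, *Automorphic forms and automorphic representations*, Corvallis PSPM 33.1 (1979), §4.4, §4.6.
* [Garrett2018] P. Garrett, *Modern Analysis of Automorphic Forms by Example* 1 (2018), §1.8.
* [Rogawski1990] J. D. Rogawski, *Automorphic Representations of Unitary Groups in Three Variables* (1990), §1.10 p. 9.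
-/

set_option autoImplicit false
set_option linter.dupNamespace false  -- the mandated namespace `…HodgeConjecture.HodgeConjecture.R90.S8` (LEAD #1 L1) repeats the summit's segment

noncomputable section

open MeasureTheory Measure Set Filter Topology NumberField
open Literature.NumberTheory.Automorphic Literature.NumberTheory.Automorphic.UnitaryGroup AdelicGroupData
open Summit.HodgeConjecture.HodgeConjecture.Cruxes.H413.K2E1CuspidalSpectrumUnitary (flagUnipotentRadical cmUnipotentRadicalR cmParabolicDataR cmCuspidalSubspaceR)
open Summit.HodgeConjecture.HodgeConjecture.Cruxes.H413.K2E1HeisenbergRadicalCocompactU3 (upperUnitriangular_eq_flagUnipotentRadical_three)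
open Summit.HodgeConjecture.HodgeConjecture.Cruxes.H413.K2E1PseudoEisensteinDensityU (cmCuspidalSubspaceR_orthogonal_eq_topologicalClosure_span_three)
open Summit.HodgeConjecture.HodgeConjecture.Cruxes.H413.K2E1CuspidalDensityQuasiSplitBridgeCMTwo (toSubmodule_cuspidalSubspace_eq_of_forall_radical_eq setOf_pseudoEisenstein_eq_of_forall_radical_eq)
open scoped ENNReal NNReal

namespace Summit.HodgeConjecture.HodgeConjecture.R90.S8

variable (L : Type) [Field L] [NumberField L] [IsCMField L]

/-! ## §1 `J`-generic by substitution -/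

/-- **★ f1's DENSITY AT `U(Φ₃)`, `J`-GENERIC**: for `J` ANY matrix equal to the literal `Φ₃`, the datum `adelicGroupData L⁺ L c 3 J` carries parabolic data with NON-EMPTY index, every radical the
inline Heisenberg radical `val_J⁻¹(flagUnipotentRadical 3 1)`, and satisfying `(L²_cusp)ᗮ = closure span {[θ_Φ] : Φ ∈ 𝒯_i}` for every automorphic `μ` (at `J = Φ₃`: the witness is ★
`cmParabolicDataR L 3`, index `{k // 1 ≤ k ∧ 2k ≤ 3} = {1}`, and the density is ★ `cmCuspidalSubspaceR_orthogonal_eq_topologicalClosure_span_three`, by `subst`).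
[cite: MoeglinWaldspurger1995, II.1.2–II.1.4] [cite: BorelJacquet1979, §4.6] -/
theorem exists_parabolicData_orthogonal_eq_of_eq_three {J : Matrix (Fin 3) (Fin 3) L} (hJ : (Matrix.of fun i j : Fin 3 => if i.val + j.val + 1 = 3 then (1 : L) else 0) = J) :
    ∃ 𝔓 : (adelicGroupData (↥(maximalRealSubfield L)) L (IsCMField.complexConj L) 3 J).ParabolicUnipotentData, Nonempty 𝔓.ι ∧
      (∀ i : 𝔓.ι, 𝔓.radical i = (flagUnipotentRadical 3 1 (AdeleRing (𝓞 L) L)).comap (adelicVal (↥(maximalRealSubfield L)) L (IsCMField.complexConj L) 3 J)) ∧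
      ∀ {mG : MeasurableSpace (adelicGroupData (↥(maximalRealSubfield L)) L (IsCMField.complexConj L) 3 J).Adelic}
        (_ : BorelSpace (adelicGroupData (↥(maximalRealSubfield L)) L (IsCMField.complexConj L) 3 J).Adelic)
        (μ : Measure (adelicGroupData (↥(maximalRealSubfield L)) L (IsCMField.complexConj L) 3 J).automorphicQuotient)
        (_ : (adelicGroupData (↥(maximalRealSubfield L)) L (IsCMField.complexConj L) 3 J).IsAutomorphicMeasure μ),
        ((adelicGroupData (↥(maximalRealSubfield L)) L (IsCMField.complexConj L) 3 J).cuspidalSubspace μ 𝔓).toSubmoduleᗮ =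
          (Submodule.span ℂ {f : (adelicGroupData (↥(maximalRealSubfield L)) L (IsCMField.complexConj L) 3 J).L2 μ |
            ∃ (i : 𝔓.ι) (Φ : (adelicGroupData (↥(maximalRealSubfield L)) L (IsCMField.complexConj L) 3 J).Adelic → ℂ) (_ : Measurable Φ)
              (_ : ∀ (g : (adelicGroupData (↥(maximalRealSubfield L)) L (IsCMField.complexConj L) 3 J).Adelic) (n : 𝔓.radical i), Φ (g * n) = Φ g)
              (_ : ∫⁻ x, (∑' q : (adelicGroupData (↥(maximalRealSubfield L)) L (IsCMField.complexConj L) 3 J).quotientSubgroup ⧸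
                  (𝔓.radical i).subgroupOf (adelicGroupData (↥(maximalRealSubfield L)) L (IsCMField.complexConj L) 3 J).quotientSubgroup,
                    ‖Φ ((Quotient.out x : (adelicGroupData (↥(maximalRealSubfield L)) L (IsCMField.complexConj L) 3 J).Adelic) *
                      (q.out : (adelicGroupData (↥(maximalRealSubfield L)) L (IsCMField.complexConj L) 3 J).Adelic))‖ₑ) ^ 2 ∂μ < ∞)
              (hθ : MemLp (fun x : (adelicGroupData (↥(maximalRealSubfield L)) L (IsCMField.complexConj L) 3 J).automorphicQuotient =>
                  ∑' q : (adelicGroupData (↥(maximalRealSubfield L)) L (IsCMField.complexConj L) 3 J).quotientSubgroup ⧸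
                    (𝔓.radical i).subgroupOf (adelicGroupData (↥(maximalRealSubfield L)) L (IsCMField.complexConj L) 3 J).quotientSubgroup,
                      Φ ((Quotient.out x : (adelicGroupData (↥(maximalRealSubfield L)) L (IsCMField.complexConj L) 3 J).Adelic) *
                        (q.out : (adelicGroupData (↥(maximalRealSubfield L)) L (IsCMField.complexConj L) 3 J).Adelic))) 2 μ),
              f = hθ.toLp _}).topologicalClosure := by
  subst hJ
  refine ⟨cmParabolicDataR L 3, ⟨⟨1, le_refl _, by norm_num⟩⟩, fun i => ?_, @fun mG hB μ hμ => ?_⟩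
  · obtain ⟨k, hk⟩ := i
    obtain rfl : k = 1 := by omega
    rfl
  · letI : MeasurableSpace (cmDatum L 3 (Matrix.of fun i j : Fin 3 => if i.val + j.val + 1 = 3 then (1 : L) else 0)).Adelic := mG
    haveI : BorelSpace (cmDatum L 3 (Matrix.of fun i j : Fin 3 => if i.val + j.val + 1 = 3 then (1 : L) else 0)).Adelic := hB
    haveI : (cmDatum L 3 (Matrix.of fun i j : Fin 3 => if i.val + j.val + 1 = 3 then (1 : L) else 0)).IsAutomorphicMeasure μ := hμ
    exact cmCuspidalSubspaceR_orthogonal_eq_topologicalClosure_span_three L μ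

/-! ## §2 The `quasiSplit` print -/

/-- **THE BRIDGE — ★ f1's CUSPIDAL DENSITY IN THE `quasiSplit L⁺ L c 3` WORLD**: there is parabolic data `𝔓` for Mok's `U(J₃)` with NON-EMPTY index and EVERY radical `= adelicUnipotent L⁺ L c 3`
(the Heisenberg radical) such that, for every automorphic `μ`, `((quasiSplit …).cuspidalSubspace μ 𝔓)ᗮ = closure span {[θ_Φ] : i, Φ ∈ 𝒯_i}` in ★ f1's `hθ`-witness shape.  §1 at
`J := (StdForm.antidiagonal 3).over L` (★ `antidiagOne_eq_over`), the radical read through ★ p855771 `upperUnitriangular_eq_flagUnipotentRadical_three` and ★ `mem_adelicUnipotent_iff`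
(`val⁻¹(R_u(P_{(1,1,1)})) = val⁻¹(upper unitriangular) = adelicUnipotent`, as ★ `comap_flagUnipotentRadical_three_one_eq_adelicUnipotent`).
[cite: MoeglinWaldspurger1995, II.1.2–II.1.4] [cite: BorelJacquet1979, §4.4, §4.6] [cite: Rogawski1990, §1.10 p. 9] -/
theorem exists_parabolicData_orthogonal_eq_quasiSplit_three :
    ∃ 𝔓 : (quasiSplit (↥(maximalRealSubfield L)) L (IsCMField.complexConj L) 3).ParabolicUnipotentData, Nonempty 𝔓.ι ∧
      (∀ i : 𝔓.ι, 𝔓.radical i = adelicUnipotent (↥(maximalRealSubfield L)) L (IsCMField.complexConj L) 3) ∧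
      ∀ {mG : MeasurableSpace (quasiSplit (↥(maximalRealSubfield L)) L (IsCMField.complexConj L) 3).Adelic}
        (_ : BorelSpace (quasiSplit (↥(maximalRealSubfield L)) L (IsCMField.complexConj L) 3).Adelic)
        (μ : Measure (quasiSplit (↥(maximalRealSubfield L)) L (IsCMField.complexConj L) 3).automorphicQuotient)
        (_ : (quasiSplit (↥(maximalRealSubfield L)) L (IsCMField.complexConj L) 3).IsAutomorphicMeasure μ),
        ((quasiSplit (↥(maximalRealSubfield L)) L (IsCMField.complexConj L) 3).cuspidalSubspace μ 𝔓).toSubmoduleᗮ =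
          (Submodule.span ℂ {f : (quasiSplit (↥(maximalRealSubfield L)) L (IsCMField.complexConj L) 3).L2 μ |
            ∃ (i : 𝔓.ι) (Φ : (quasiSplit (↥(maximalRealSubfield L)) L (IsCMField.complexConj L) 3).Adelic → ℂ) (_ : Measurable Φ)
              (_ : ∀ (g : (quasiSplit (↥(maximalRealSubfield L)) L (IsCMField.complexConj L) 3).Adelic) (n : 𝔓.radical i), Φ (g * n) = Φ g)
              (_ : ∫⁻ x, (∑' q : (quasiSplit (↥(maximalRealSubfield L)) L (IsCMField.complexConj L) 3).quotientSubgroup ⧸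
                  (𝔓.radical i).subgroupOf (quasiSplit (↥(maximalRealSubfield L)) L (IsCMField.complexConj L) 3).quotientSubgroup,
                    ‖Φ ((Quotient.out x : (quasiSplit (↥(maximalRealSubfield L)) L (IsCMField.complexConj L) 3).Adelic) *
                      (q.out : (quasiSplit (↥(maximalRealSubfield L)) L (IsCMField.complexConj L) 3).Adelic))‖ₑ) ^ 2 ∂μ < ∞)
              (hθ : MemLp (fun x : (quasiSplit (↥(maximalRealSubfield L)) L (IsCMField.complexConj L) 3).automorphicQuotient =>
                  ∑' q : (quasiSplit (↥(maximalRealSubfield L)) L (IsCMField.complexConj L) 3).quotientSubgroup ⧸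
                    (𝔓.radical i).subgroupOf (quasiSplit (↥(maximalRealSubfield L)) L (IsCMField.complexConj L) 3).quotientSubgroup,
                      Φ ((Quotient.out x : (quasiSplit (↥(maximalRealSubfield L)) L (IsCMField.complexConj L) 3).Adelic) *
                        (q.out : (quasiSplit (↥(maximalRealSubfield L)) L (IsCMField.complexConj L) 3).Adelic))) 2 μ),
              f = hθ.toLp _}).topologicalClosure := by
  -- the Heisenberg radical of the route IS the tree's unipotent radical at Mok's `J₃` (★ p855771 + ★ `mem_adelicUnipotent_iff`)
  have hrad : (flagUnipotentRadical 3 1 (AdeleRing (𝓞 L) L)).comap (adelicVal (↥(maximalRealSubfield L)) L (IsCMField.complexConj L) 3 ((StdForm.antidiagonal 3).over L)) =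
      adelicUnipotent (↥(maximalRealSubfield L)) L (IsCMField.complexConj L) 3 := by
    rw [← upperUnitriangular_eq_flagUnipotentRadical_three (AdeleRing (𝓞 L) L)]
    exact Subgroup.ext fun g => (mem_adelicUnipotent_iff g).symm
  obtain ⟨𝔓, hne, h𝔓, hE⟩ := exists_parabolicData_orthogonal_eq_of_eq_three L (antidiagOne_eq_over (L := L) (N := 3))
  exact ⟨𝔓, hne, fun i => (h𝔓 i).trans hrad, fun hB μ hμ => hE hB μ hμ⟩

/-! ## §3 The ∀-guarded density: every Borel parabolic datum of `quasiSplit L⁺ L c 3` -/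

/-- **THE ∀-GUARDED BRIDGE: ★ f1's CUSPIDAL DENSITY FOR EVERY BOREL PARABOLIC DATUM OF `quasiSplit L⁺ L c 3`** — for EVERY `𝔓` with non-empty index and all radicals `= adelicUnipotent L⁺ L c 3`
(the `𝔓` of (HEAD₃)'s `hHead_level`; NOT satisfiable by the junk datum `⟨PEmpty, nofun⟩`): `((quasiSplit …).cuspidalSubspace μ 𝔓)ᗮ = closure span Θ(𝔓, μ)` — §2 + ★ CMTwo §3 (both sides
depend only on the SET of radicals: ★ `toSubmodule_cuspidalSubspace_eq_of_forall_radical_eq`, ★ `setOf_pseudoEisenstein_eq_of_forall_radical_eq`).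
[cite: MoeglinWaldspurger1995, II.1.2–II.1.4, II.2.4] [cite: BorelJacquet1979, §4.6] [cite: Garrett2018, §1.8] -/
theorem orthogonal_eq_topologicalClosure_span_of_borel_three (𝔓 : (quasiSplit (↥(maximalRealSubfield L)) L (IsCMField.complexConj L) 3).ParabolicUnipotentData) (hne : Nonempty 𝔓.ι)
    (h𝔓 : ∀ i : 𝔓.ι, 𝔓.radical i = adelicUnipotent (↥(maximalRealSubfield L)) L (IsCMField.complexConj L) 3)
    [MeasurableSpace (quasiSplit (↥(maximalRealSubfield L)) L (IsCMField.complexConj L) 3).Adelic] [BorelSpace (quasiSplit (↥(maximalRealSubfield L)) L (IsCMField.complexConj L) 3).Adelic]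
    (μ : Measure (quasiSplit (↥(maximalRealSubfield L)) L (IsCMField.complexConj L) 3).automorphicQuotient) [(quasiSplit (↥(maximalRealSubfield L)) L (IsCMField.complexConj L) 3).IsAutomorphicMeasure μ] :
    ((quasiSplit (↥(maximalRealSubfield L)) L (IsCMField.complexConj L) 3).cuspidalSubspace μ 𝔓).toSubmoduleᗮ =
      (Submodule.span ℂ {f : (quasiSplit (↥(maximalRealSubfield L)) L (IsCMField.complexConj L) 3).L2 μ |
        ∃ (i : 𝔓.ι) (Φ : (quasiSplit (↥(maximalRealSubfield L)) L (IsCMField.complexConj L) 3).Adelic → ℂ) (_ : Measurable Φ)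
          (_ : ∀ (g : (quasiSplit (↥(maximalRealSubfield L)) L (IsCMField.complexConj L) 3).Adelic) (n : 𝔓.radical i), Φ (g * n) = Φ g)
          (_ : ∫⁻ x, (∑' q : (quasiSplit (↥(maximalRealSubfield L)) L (IsCMField.complexConj L) 3).quotientSubgroup ⧸ (𝔓.radical i).subgroupOf (quasiSplit (↥(maximalRealSubfield L)) L (IsCMField.complexConj L) 3).quotientSubgroup,
              ‖Φ ((Quotient.out x : (quasiSplit (↥(maximalRealSubfield L)) L (IsCMField.complexConj L) 3).Adelic) * ((q.out : (quasiSplit (↥(maximalRealSubfield L)) L (IsCMField.complexConj L) 3).quotientSubgroup) : (quasiSplit (↥(maximalRealSubfield L)) L (IsCMField.complexConj L) 3).Adelic))‖ₑ) ^ 2 ∂μ < ∞)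
          (hθ : MemLp (fun x : (quasiSplit (↥(maximalRealSubfield L)) L (IsCMField.complexConj L) 3).automorphicQuotient => ∑' q : (quasiSplit (↥(maximalRealSubfield L)) L (IsCMField.complexConj L) 3).quotientSubgroup ⧸ (𝔓.radical i).subgroupOf (quasiSplit (↥(maximalRealSubfield L)) L (IsCMField.complexConj L) 3).quotientSubgroup,
              Φ ((Quotient.out x : (quasiSplit (↥(maximalRealSubfield L)) L (IsCMField.complexConj L) 3).Adelic) * ((q.out : (quasiSplit (↥(maximalRealSubfield L)) L (IsCMField.complexConj L) 3).quotientSubgroup) : (quasiSplit (↥(maximalRealSubfield L)) L (IsCMField.complexConj L) 3).Adelic))) 2 μ),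
          f = hθ.toLp _}).topologicalClosure := by
  obtain ⟨𝔓₀, hne₀, h𝔓₀, hE₀⟩ := exists_parabolicData_orthogonal_eq_quasiSplit_three L
  haveI := hne; haveI := hne₀
  have hrad : ∀ (i : 𝔓.ι) (j : 𝔓₀.ι), 𝔓.radical i = 𝔓₀.radical j := fun i j => by rw [h𝔓 i, h𝔓₀ j]
  rw [toSubmodule_cuspidalSubspace_eq_of_forall_radical_eq μ 𝔓 𝔓₀ hrad, setOf_pseudoEisenstein_eq_of_forall_radical_eq μ 𝔓 𝔓₀ hrad]
  exact hE₀ inferInstance μ inferInstance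

/-- **THE NAMED HALF `(L²_cusp)ᗮ ≤ closure span Θ(𝔓, μ)`** for every Borel parabolic datum `𝔓` of `quasiSplit L⁺ L c 3` with non-empty index and radicals `= adelicUnipotent` — the direction
the LEVEL exhaustion letter (HEAD₃) (`hHead_level` of ★ `hHead_kType_of_level_three`) and the generic level cut ★ `orthogonal_inf_iInf_eigenspace_eq_topologicalClosure_span_nice` start from
[MW II.2.4: every non-cuspidal `L²` vector is a limit of pseudo-Eisenstein series]. [cite: MoeglinWaldspurger1995, II.1.2–II.1.4, II.2.4] [cite: Garrett2018, §1.8] -/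
theorem cuspidalSubspace_orthogonal_le_topologicalClosure_span_of_borel_three (𝔓 : (quasiSplit (↥(maximalRealSubfield L)) L (IsCMField.complexConj L) 3).ParabolicUnipotentData) (hne : Nonempty 𝔓.ι)
    (h𝔓 : ∀ i : 𝔓.ι, 𝔓.radical i = adelicUnipotent (↥(maximalRealSubfield L)) L (IsCMField.complexConj L) 3)
    [MeasurableSpace (quasiSplit (↥(maximalRealSubfield L)) L (IsCMField.complexConj L) 3).Adelic] [BorelSpace (quasiSplit (↥(maximalRealSubfield L)) L (IsCMField.complexConj L) 3).Adelic]
    (μ : Measure (quasiSplit (↥(maximalRealSubfield L)) L (IsCMField.complexConj L) 3).automorphicQuotient) [(quasiSplit (↥(maximalRealSubfield L)) L (IsCMField.complexConj L) 3).IsAutomorphicMeasure μ] :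
    ((quasiSplit (↥(maximalRealSubfield L)) L (IsCMField.complexConj L) 3).cuspidalSubspace μ 𝔓).toSubmoduleᗮ ≤
      (Submodule.span ℂ {f : (quasiSplit (↥(maximalRealSubfield L)) L (IsCMField.complexConj L) 3).L2 μ |
        ∃ (i : 𝔓.ι) (Φ : (quasiSplit (↥(maximalRealSubfield L)) L (IsCMField.complexConj L) 3).Adelic → ℂ) (_ : Measurable Φ)
          (_ : ∀ (g : (quasiSplit (↥(maximalRealSubfield L)) L (IsCMField.complexConj L) 3).Adelic) (n : 𝔓.radical i), Φ (g * n) = Φ g)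
          (_ : ∫⁻ x, (∑' q : (quasiSplit (↥(maximalRealSubfield L)) L (IsCMField.complexConj L) 3).quotientSubgroup ⧸ (𝔓.radical i).subgroupOf (quasiSplit (↥(maximalRealSubfield L)) L (IsCMField.complexConj L) 3).quotientSubgroup,
              ‖Φ ((Quotient.out x : (quasiSplit (↥(maximalRealSubfield L)) L (IsCMField.complexConj L) 3).Adelic) * ((q.out : (quasiSplit (↥(maximalRealSubfield L)) L (IsCMField.complexConj L) 3).quotientSubgroup) : (quasiSplit (↥(maximalRealSubfield L)) L (IsCMField.complexConj L) 3).Adelic))‖ₑ) ^ 2 ∂μ < ∞)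
          (hθ : MemLp (fun x : (quasiSplit (↥(maximalRealSubfield L)) L (IsCMField.complexConj L) 3).automorphicQuotient => ∑' q : (quasiSplit (↥(maximalRealSubfield L)) L (IsCMField.complexConj L) 3).quotientSubgroup ⧸ (𝔓.radical i).subgroupOf (quasiSplit (↥(maximalRealSubfield L)) L (IsCMField.complexConj L) 3).quotientSubgroup,
              Φ ((Quotient.out x : (quasiSplit (↥(maximalRealSubfield L)) L (IsCMField.complexConj L) 3).Adelic) * ((q.out : (quasiSplit (↥(maximalRealSubfield L)) L (IsCMField.complexConj L) 3).quotientSubgroup) : (quasiSplit (↥(maximalRealSubfield L)) L (IsCMField.complexConj L) 3).Adelic))) 2 μ),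
          f = hθ.toLp _}).topologicalClosure :=
  (orthogonal_eq_topologicalClosure_span_of_borel_three L 𝔓 hne h𝔓 μ).le

/-- **… and the other half: every square-integrable pseudo-Eisenstein class is orthogonal to the cuspidal subspace** (`closure span Θ(𝔓, μ) ≤ (L²_cusp)ᗮ`), for the same `𝔓`.
[cite: MoeglinWaldspurger1995, II.1.2–II.1.4] [cite: BorelJacquet1979, §4.6] -/
theorem topologicalClosure_span_le_cuspidalSubspace_orthogonal_of_borel_three (𝔓 : (quasiSplit (↥(maximalRealSubfield L)) L (IsCMField.complexConj L) 3).ParabolicUnipotentData) (hne : Nonempty 𝔓.ι)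
    (h𝔓 : ∀ i : 𝔓.ι, 𝔓.radical i = adelicUnipotent (↥(maximalRealSubfield L)) L (IsCMField.complexConj L) 3)
    [MeasurableSpace (quasiSplit (↥(maximalRealSubfield L)) L (IsCMField.complexConj L) 3).Adelic] [BorelSpace (quasiSplit (↥(maximalRealSubfield L)) L (IsCMField.complexConj L) 3).Adelic]
    (μ : Measure (quasiSplit (↥(maximalRealSubfield L)) L (IsCMField.complexConj L) 3).automorphicQuotient) [(quasiSplit (↥(maximalRealSubfield L)) L (IsCMField.complexConj L) 3).IsAutomorphicMeasure μ] :
    (Submodule.span ℂ {f : (quasiSplit (↥(maximalRealSubfield L)) L (IsCMField.complexConj L) 3).L2 μ |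
        ∃ (i : 𝔓.ι) (Φ : (quasiSplit (↥(maximalRealSubfield L)) L (IsCMField.complexConj L) 3).Adelic → ℂ) (_ : Measurable Φ)
          (_ : ∀ (g : (quasiSplit (↥(maximalRealSubfield L)) L (IsCMField.complexConj L) 3).Adelic) (n : 𝔓.radical i), Φ (g * n) = Φ g)
          (_ : ∫⁻ x, (∑' q : (quasiSplit (↥(maximalRealSubfield L)) L (IsCMField.complexConj L) 3).quotientSubgroup ⧸ (𝔓.radical i).subgroupOf (quasiSplit (↥(maximalRealSubfield L)) L (IsCMField.complexConj L) 3).quotientSubgroup,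
              ‖Φ ((Quotient.out x : (quasiSplit (↥(maximalRealSubfield L)) L (IsCMField.complexConj L) 3).Adelic) * ((q.out : (quasiSplit (↥(maximalRealSubfield L)) L (IsCMField.complexConj L) 3).quotientSubgroup) : (quasiSplit (↥(maximalRealSubfield L)) L (IsCMField.complexConj L) 3).Adelic))‖ₑ) ^ 2 ∂μ < ∞)
          (hθ : MemLp (fun x : (quasiSplit (↥(maximalRealSubfield L)) L (IsCMField.complexConj L) 3).automorphicQuotient => ∑' q : (quasiSplit (↥(maximalRealSubfield L)) L (IsCMField.complexConj L) 3).quotientSubgroup ⧸ (𝔓.radical i).subgroupOf (quasiSplit (↥(maximalRealSubfield L)) L (IsCMField.complexConj L) 3).quotientSubgroup,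
              Φ ((Quotient.out x : (quasiSplit (↥(maximalRealSubfield L)) L (IsCMField.complexConj L) 3).Adelic) * ((q.out : (quasiSplit (↥(maximalRealSubfield L)) L (IsCMField.complexConj L) 3).quotientSubgroup) : (quasiSplit (↥(maximalRealSubfield L)) L (IsCMField.complexConj L) 3).Adelic))) 2 μ),
          f = hθ.toLp _}).topologicalClosure ≤
      ((quasiSplit (↥(maximalRealSubfield L)) L (IsCMField.complexConj L) 3).cuspidalSubspace μ 𝔓).toSubmoduleᗮ :=
  (orthogonal_eq_topologicalClosure_span_of_borel_three L 𝔓 hne h𝔓 μ).ge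

end Summit.HodgeConjecture.HodgeConjecture.R90.S8

end
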